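import Summits.BirchSwinnertonDyer.BirchSwinnertonDyer.Theorems.PrintCf2RamifiedOffTYZEvenSquareFormMatrixBridge
import Summits.BirchSwinnertonDyer.BirchSwinnertonDyer.Theorems.PrintCf2RamifiedOffTYZSquareSilenceStabiliser
import Summits.BirchSwinnertonDyer.BirchSwinnertonDyer.Theorems.PrintCf2RamifiedOffTYZSelmerRankOneSixPure
import Literature.LinearAlgebra.Matrix.AdjugateRank
import HarnessLib

/-!
# Crux `PrintCf2.RamifiedOffTYZOfFacts` (stmt-BirchSwinnertonDyer-20509), line `offtyz-v7`, LEAD cycle 14 (cruxlead-20509 g13):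
# THE EVEN Ω-IDENTITY ⟹ FULL LAYER-1 SILENCE AT `s ≥ 2` ⟹ THE EVEN LOWER HALF OF C⁺ FOR ALL `k` (conditional on a pure Legendre-symbol identity)

THEOREMS ONLY (no `def`, no named fact, no `sorry`), `--supports stmt-BirchSwinnertonDyer-20509` (C⁺ = item 23431, even sector).  The consumer of the
closed-form reduction `galPt_mul_self_P_eq_add_evenSquareFormMatrix` (`…EvenSquareFormMatrixBridge`): IF the even Ω-identity holds for the tuple `p`
(`∀ x, evenSquareFormMatrix p x = evenOmegaFormMatrix p x`; conjecture `EvenOmegaMatrixIdentity` of the crux workfile `Lines/offtyz_v7_EvenOmega.lean`,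
verified for every square-free `n = 2∏pᵢ ≤ 10⁵`, `k ≤ 5`), then for `#Sel₂(E_n) = 2^{2+s}`, `s ≥ 2`, Monsky's even formula (tree theorem) gives
`rank M_even ≤ 2k − 2`, hence `adj M_even = 0` (Horn–Johnson §0.8.2, tree), `evenOmegaFormMatrix p ≡ 0`, and EVERY square of `Gal(ℍ′_n/ℚ)` fixes
`P(n)` (§1–§2); with g11's even door (p729925) and even half-mover (p733231) this is the LOWER HALF `2 ∣ 𝓛(n)` on the whole even jump-one class
(§3, display shape and `OfFacts` shape).  The hypothesis is an explicit, decidable `𝔽₂`-identity in Legendre symbols — NOT a named fact and NOT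
asserted; the theorems are honest implications.  BSD is not proved by any of this; no class is closed by this file.

References: [cite: TianYuanZhang2017, Thm. 1.1, Thm. 3.5, Lemma 3.18, §3.1, Prop. 3.2 (1)(2), Thm. 3.6 (1)(2), proof of Lemma 3.21, §1 (p0002 L101–L110)];
[cite: HeathBrown1994SelmerCongruentII, Appendix (Monsky), typescript p. 41 L20–L36]; [cite: HornJohnson2013, §0.8.2 (p. 22)]; [cite: Darmon2004, Thm. 3.22].
-/

noncomputable section

open scoped Classical NumberField

open WeierstrassCurve WeierstrassCurve.Affine Finset Matrix Literature.NumberTheory.EllipticCurves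
  Literature.NumberTheory.EllipticCurves.TianYuanZhang2017
  Literature.NumberTheory.EllipticCurves.TianYuanZhang2017.W2
  Literature.NumberTheory.EllipticCurves.HeathBrown1994
  Literature.NumberTheory.EllipticCurves.HeathBrown1994.Families
  Literature.NumberTheory.EllipticCurves.Smith2016
  Literature.NumberTheory.EllipticCurves.MonskySelmerParity
  Literature.NumberTheory.QuadraticFields.RingClass
  Literature.NumberTheory.QuadraticFields
  Literature.LinearAlgebra.Matrix
  Summit.BirchSwinnertonDyer.Rank1Residual.P2.GenusPeriodTransferLayer
  Summit.BirchSwinnertonDyer.Rank1Residual.P2.ThetaDescent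
  Summit.BirchSwinnertonDyer.Rank1Residual.P2
  Summit.BirchSwinnertonDyer.PrintCf2.QForm
  Summit.BirchSwinnertonDyer.PrintCf2.EvenOmegaDefs
  Summit.BirchSwinnertonDyer.PrintCf2.LowerHalfDoor
  Summit.BirchSwinnertonDyer.PrintCf2.LowerHalfDoorEven
  Summit.BirchSwinnertonDyer.PrintCf2.LowerHalfTwoPrimesEven

set_option autoImplicit false

namespace Summit.BirchSwinnertonDyer.PrintCf2.MoverAssembly

variable {k : ℕ} (p : Fin k → ℕ) (hp : ∀ i, (p i).Prime) (hodd : ∀ i, Odd (p i)) (hinj : Function.Injective p)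

/-! ## §1 `s ≥ 2` kills the adjugate of Monsky's even matrix, hence the even Ω-form -/

/-- **`rank M_even + 2 ≤ 2k ⟹ adj M_even = 0`** (all `(2k−1)`-minors vanish; re-indexed to `Fin (k + k)`). [cite: HornJohnson2013, §0.8.2 (p. 22)] -/
theorem adjugate_monskyMatrixEven_eq_zero_of_rank (h : (monskyMatrixEven p).rank + 2 ≤ 2 * k) : (monskyMatrixEven p).adjugate = 0 := by
  set e : Fin (k + k) ≃ Fin k ⊕ Fin k := finSumFinEquiv.symm with he
  have hB : ((monskyMatrixEven p).submatrix e e).adjugate = 0 := by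
    apply adjugate_eq_zero_of_rank_add_two_le
    rw [Matrix.rank_submatrix, Fintype.card_fin]; omega
  rw [Matrix.adjugate_submatrix_equiv_self] at hB
  ext i j
  have hij := congrFun (congrFun hB (e.symm i)) (e.symm j)
  rw [Matrix.submatrix_apply, Equiv.apply_symm_apply, Equiv.apply_symm_apply] at hij
  exact hij

include hp hodd hinj in
/-- **`#Sel₂(E_{2∏pᵢ}) = 2^{2+s}` with `s ≥ 2` ⟹ `adj M_even = 0`** (Monsky's even formula `s = 2k − rank M_even`, tree theorem).
[cite: HeathBrown1994SelmerCongruentII, Appendix (Monsky), typescript p. 41 L20–L36] [cite: HornJohnson2013, §0.8.2] -/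
theorem adjugate_monskyMatrixEven_eq_zero_of_card_selmer {s : ℕ} (hs : 2 ≤ s)
    (hsel : Nat.card ((congruentNumberCurve (2 * ∏ i, p i)).selmerGroup 2) = 2 ^ (2 + s)) : (monskyMatrixEven p).adjugate = 0 := by
  rw [monsky_card_selmerGroup_two_even_holds k p hp hodd hinj] at hsel
  have hs' : monskySelmerRankEven p = s := by
    have := Nat.pow_right_injective le_rfl hsel; omega
  have hrank : (monskyMatrixEven p).rank ≤ 2 * k := by
    have h := Matrix.rank_le_card_width (monskyMatrixEven p)
    rwa [Fintype.card_sum, Fintype.card_fin, ← two_mul] at h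
  apply adjugate_monskyMatrixEven_eq_zero_of_rank p
  unfold monskySelmerRankEven at hs'
  omega

/-- **`adj M_even = 0 ⟹ evenOmegaFormMatrix p ≡ 0`.** [cite: HeathBrown1994SelmerCongruentII, Appendix (Monsky)] -/
theorem evenOmegaFormMatrix_eq_zero_of_adjugate (h : (monskyMatrixEven p).adjugate = 0) (xim x2 : ZMod 2) (x : Fin k → ZMod 2) :
    evenOmegaFormMatrix p xim x2 x = 0 := by
  unfold evenOmegaFormMatrix
  simp only [h, Matrix.zero_apply, add_zero, mul_zero, zero_mul, Finset.sum_const_zero, ite_self]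

variable {n : ℕ} (D : GenusPointData n)

/-! ## §2 Full Layer-1 silence at `s ≥ 2` under the even Ω-identity for the tuple -/

include hp hodd hinj in
/-- **SILENCE.**  Under the even Ω-identity for `p` and `#Sel₂(E_n) = 2^{2+s}`, `s ≥ 2` (`n = 2∏pᵢ`, `∏pᵢ ≡ 3 (4)`, the displays, Thm 1.1): every
square of `Gal(ℍ′_n/ℚ)` fixes `P(n)`. [cite: TianYuanZhang2017, §3.1, Thm. 3.6 (1)(2), proof of Lemma 3.21] [cite: HeathBrown1994SelmerCongruentII, Appendix (Monsky)] -/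
theorem galPt_mul_self_P_eq_of_evenOmega (hn : n = 2 * ∏ i, p i) (h3 : (∏ i, p i) % 4 = 3) (hrec : D.recursion)
    (hLs : D.scriptLSpec) (h11 : thm11_parity_of_scriptL)
    (hΩ : ∀ (xim x2 : ZMod 2) (x : Fin k → ZMod 2), evenSquareFormMatrix p xim x2 x = evenOmegaFormMatrix p xim x2 x)
    {s : ℕ} (hs : 2 ≤ s) (hsel : Nat.card ((congruentNumberCurve n).selmerGroup 2) = 2 ^ (2 + s))
    {zf : ℕ → APoint D.H} {Φf : ℕ → Finset (D.H ≃ₐ[ℚ] D.H)} {ΓHf ΓH'f : ℕ → Subgroup (D.H ≃ₐ[ℚ] D.H)}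
    {σf θf : ℕ → (D.H ≃ₐ[ℚ] D.H)} {cf : D.H ≃ₐ[ℚ] D.H} (hc : D.ConjSpec cf)
    {ρ₂ : (d : ℕ) → (D.galK d →* RingClassGroup (GenusField d) 2)}
    {ρ₄ : (d : ℕ) → (D.galK d →* RingClassGroup (GenusField d) 4)}
    (hb : ∀ d ∈ n.divisors,
      ((d % 8 = 5 ∨ d % 8 = 6) → D.CMBlockSpec d (zf d) (Φf d) (ΓHf d) (ΓH'f d) (σf d) cf) ∧
      (d % 8 = 6 → D.ThetaBlockSpec d (zf d) (ΓHf d) (ΓH'f d) (σf d) (θf d)) ∧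
      (d % 8 = 7 → D.SevenBlockSpec d) ∧
      (d % 8 = 5 → D.RingClassTwoBlockSpec d (ΓHf d) (ΓH'f d) (ρ₂ d)) ∧
      (d % 8 = 6 → D.RingClassFourBlockSpec d (ΓHf d) (ΓH'f d) (ρ₄ d)) ∧
      (d % 8 = 5 → D.FrobeniusTwoBlockSpec d (ΓH'f d)) ∧
      (d % 8 = 6 → D.FrobeniusFourBlockSpec d (ΓH'f d)) ∧
      (d % 8 = 6 → D.FrobeniusFourValueBlockSpec d (ΓH'f d) (ρ₄ d)))
    (g : D.H ≃ₐ[ℚ] D.H) : D.galPt (g * g) (D.P n) = D.P n := by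
  refine galPt_mul_self_P_eq_of_evenSquareFormMatrix_eq_zero p hp hodd hinj D hn h3 hrec hLs h11 hc hb g ?_
  rw [hΩ]
  refine evenOmegaFormMatrix_eq_zero_of_adjugate p (adjugate_monskyMatrixEven_eq_zero_of_card_selmer p hp hodd hinj hs ?_) _ _ _
  rw [← hn]; exact hsel

/-! ## §3 The even lower half of C⁺ for all `k`, under the even Ω-identity for the tuple -/

include hp hodd hinj in
/-- **THE LOWER HALF OF C⁺ ON THE WHOLE EVEN JUMP-ONE CLASS, under the even Ω-identity for the tuple** (display shape): `n = 2∏pᵢ` square-free,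
`∏pᵢ ≡ 3 (mod 4)`, `#Sel₂(E_n) = 2^{2+s}` with `s ≥ 2`, analytic rank one, GZK, `D.Printed ∧ D.CMPointRingClassFrobeniusValuePrinted`, Thm 1.1, a
generator `R = (x, y)` modulo torsion with `x ∉ {±1, ±2, ±n, ±2n}·ℚ^{×2}`.  Then every `L` with `𝓛(n)² = L²` is even.
[cite: TianYuanZhang2017, Thm. 1.1, Thm. 3.5, Lemma 3.18, §3.1, Prop. 3.2, Thm. 3.6, proof of Lemma 3.21] [cite: Darmon2004, Thm. 3.22] -/
theorem two_dvd_scriptL_even_of_evenOmega (hGZK : rank_eq_analyticRank_of_analyticRank_le_one) (h11 : thm11_parity_of_scriptL)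
    (hn : n = 2 * ∏ i, p i) (h3 : (∏ i, p i) % 4 = 3) (hsq : Squarefree n)
    (hΩ : ∀ (xim x2 : ZMod 2) (x : Fin k → ZMod 2), evenSquareFormMatrix p xim x2 x = evenOmegaFormMatrix p xim x2 x)
    {s : ℕ} (hs : 2 ≤ s) (hsel : Nat.card ((congruentNumberCurve n).selmerGroup 2) = 2 ^ (2 + s))
    (hra : haveI := isElliptic_congruentNumberCurve hsq.ne_zero; (congruentNumberCurve n).analyticRank = 1)
    (hPr : D.Printed) (hV : D.CMPointRingClassFrobeniusValuePrinted)
    {x y : ℚ} (hxy : (congruentNumberCurve n).toAffine.Nonsingular x y)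
    (hgen : haveI := isElliptic_congruentNumberCurve hsq.ne_zero;
      ∀ P, ∃ m : ℤ, IsOfFinAddOrder (P - m • (Point.some x y hxy : (congruentNumberCurve n).toAffine.Point)))
    (hx : ¬ ∃ r : ℚ, x = r ^ 2 ∨ x = -r ^ 2 ∨ x = n * r ^ 2 ∨ x = -(n * r ^ 2))
    (hx2 : ¬ ∃ r : ℚ, x = 2 * r ^ 2 ∨ x = -(2 * r ^ 2) ∨ x = 2 * n * r ^ 2 ∨ x = -(2 * n * r ^ 2)) :
    ∀ L : ℤ, IsScriptL n L → (2 : ℤ) ∣ L := by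
  haveI := isElliptic_congruentNumberCurve hsq.ne_zero
  have hp2 : ∀ i, p i ≠ 2 := ne_two_of_odd p hodd
  have hmodd : Odd (∏ i, p i) := odd_prod p hp hp2
  have h6 : n % 8 = 6 := by rcases hmodd with ⟨r, hr⟩; omega
  have hnn : n ∈ n.divisors := Nat.mem_divisors_self n hsq.ne_zero
  obtain ⟨hLs, -, hrec, -, h35, -, -, -, h318, -, -⟩ := hPr
  obtain ⟨z, Φ, ΓH, ΓH', σ, θ, cc, ρ₂, ρ₄, hcc, hbl⟩ := hV
  obtain ⟨Q₁, hQ₁⟩ := twist_halving hsq hnn D (Point.some x y hxy)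
  obtain ⟨g₀, hgi, hg2, hgK, hmoveQ⟩ :=
    LowerHalfTwoPrimesEven.exists_halfMover_even_of_x_not_mem hsq (Nat.dvd_of_mod_eq_zero (by omega)) D hxy hx hx2 hQ₁
  have hsq0 := galPt_mul_self_P_eq_of_evenOmega p hp hodd hinj D hn h3 hrec hLs h11 hΩ hs hsel hcc hbl g₀
  exact two_dvd_scriptL_of_halfMover_of_sq_eq_even hGZK hsq h6 hra D h35 hLs h318 hgen hQ₁ g₀ hgi hg2 hgK hmoveQ hsq0

include hp hodd hinj in
/-- **THE EVEN LOWER HALF OF C⁺ FOR ALL `k` FROM THE NAMED FACTS, CONDITIONAL ON THE EVEN Ω-IDENTITY FOR THE TUPLE** (`OfFacts` shape):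
`(tyz_cmPointRingClassFrobeniusValueData ∧ thm11_parity_of_scriptL ∧ GZK)` and `∀ x, evenSquareFormMatrix p x = evenOmegaFormMatrix p x` imply — for
`n = 2∏pᵢ` square-free, `∏pᵢ ≡ 3 (mod 4)`, `#Sel₂(E_n) = 2^{2+s}`, `s ≥ 2`, `ord_{s=1} L(E_n, s) = 1`, and a generator with `x ∉ {±1, ±2, ±n, ±2n}·ℚ^{×2}` —
that `2 ∣ L` whenever `𝓛(n)² = L²`. [cite: TianYuanZhang2017, Thm. 1.1, §1, §3] [cite: HeathBrown1994SelmerCongruentII, Appendix (Monsky)] [cite: Darmon2004, Thm. 3.22] -/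
theorem two_dvd_scriptL_even_of_evenOmega_of_facts
    (hF : tyz_cmPointRingClassFrobeniusValueData ∧ thm11_parity_of_scriptL ∧ rank_eq_analyticRank_of_analyticRank_le_one)
    (hΩ : ∀ (xim x2 : ZMod 2) (x : Fin k → ZMod 2), evenSquareFormMatrix p xim x2 x = evenOmegaFormMatrix p xim x2 x)
    (hn : n = 2 * ∏ i, p i) (h3 : (∏ i, p i) % 4 = 3) (hsq : Squarefree n)
    {s : ℕ} (hs : 2 ≤ s) (hsel : Nat.card ((congruentNumberCurve n).selmerGroup 2) = 2 ^ (2 + s))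
    (hra : haveI := isElliptic_congruentNumberCurve hsq.ne_zero; (congruentNumberCurve n).analyticRank = 1)
    {x y : ℚ} (hxy : (congruentNumberCurve n).toAffine.Nonsingular x y)
    (hgen : haveI := isElliptic_congruentNumberCurve hsq.ne_zero;
      ∀ P, ∃ m : ℤ, IsOfFinAddOrder (P - m • (Point.some x y hxy : (congruentNumberCurve n).toAffine.Point)))
    (hx : ¬ ∃ r : ℚ, x = r ^ 2 ∨ x = -r ^ 2 ∨ x = n * r ^ 2 ∨ x = -(n * r ^ 2))
    (hx2 : ¬ ∃ r : ℚ, x = 2 * r ^ 2 ∨ x = -(2 * r ^ 2) ∨ x = 2 * n * r ^ 2 ∨ x = -(2 * n * r ^ 2)) :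
    ∀ L : ℤ, IsScriptL n L → (2 : ℤ) ∣ L := by
  have hp2 : ∀ i, p i ≠ 2 := ne_two_of_odd p hodd
  have hmodd : Odd (∏ i, p i) := odd_prod p hp hp2
  have h6 : n % 8 = 6 := by rcases hmodd with ⟨r, hr⟩; omega
  obtain ⟨D, hPr, hV⟩ := hF.1 n hsq (Or.inr (Or.inl h6))
  exact two_dvd_scriptL_even_of_evenOmega p hp hodd hinj D hF.2.2 hF.2.1 hn h3 hsq hΩ hs hsel hra hPr hV hxy hgen hx hx2

end Summit.BirchSwinnertonDyer.PrintCf2.MoverAssembly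

end
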